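import Summits.BirchSwinnertonDyer.BirchSwinnertonDyer.Theorems.SignedLowerHalvesSmallImageLowerHalfBothSignsValveFloor
import HarnessLib

/-!
# Route `SignedLowerHalves`, crux L `SmallImageLowerHalfBothSigns` (item stmt-BirchSwinnertonDyer-23599), line `rtt_w3` — crux idea `valve`:
# the floor from B1, keyed to the K-chain's depleted form (`…RttKanDepletedForm.exists_depletedForm` shape)

Width seat `bsd-line-slh-p3-w3` g15 under LEAD `cruxlead-stmt-BirchSwinnertonDyer-23599` (cell `bsd-ssimc`); ROUTE-INDEPENDENT helper
(`--supports stmt-BirchSwinnertonDyer-23599`); THEOREMS ONLY (no definition, no named fact, no `sorry`); closes nothing; BSD / crux L / crux M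
are proved for NO curve by this. Glue for the assembler: `…ValveFloor.muOneSign_body_of_orbitUnitCert` asks the depletion identity of `f₁` with
INTEGER Euler factors `P_i ∈ ℤ[X]`, `P_i(0) = 1`, and arguments `(∏ℓ^{k})·x`; the K-chain's depleted form (`exists_depletedForm` for the newform `f`
of `W` and a finite set `S₀` of places `v`, `ℓ_v = natGenerator v`) states it with the ℂ-polynomials `1 − C(a_{ℓ_v}(f))X + 𝟙_{ℓ_v∤N} ℓ_v X²` and
arguments `x·(∏ℓ_v^{k_v})`. Since `a_n(f) = L(W)(n) ∈ ℤ` (`IsNewformOf`), the two shapes agree: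

* ★ `muOneSign_body_of_orbitUnitCert_of_depletedForm` — the floor stub body `∃ ε L, IsSignedPAdicLFunction f p ε L ∧ HasUnitContent L` at
  `(W, p, f)` from the Vatsal OUTPUT clauses at a pair `(f₁, g₁)`, the depletion identity of `f₁` in `exists_depletedForm`'s VERBATIM shape
  (`S₀` not above `p`), and brick B1 on `g₁` — B2 discharged by `…ValveDepletion.exists_norm_depletedSymbol_eq_one`.

References: [GreenbergVatsal2000] §1 (8); [Vatsal1999] Thm. (1.13), Rem. (1.12); [MazurTateTeitelbaum1986Invent] §I.10 (10.1); [Pollack2003] Conj. 6.3.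
-/

set_option autoImplicit false
-- D-0017: single-problem summit, the namespace repeats the problem name by design.
set_option linter.dupNamespace false
noncomputable section

open scoped Classical MatrixGroups ModularForm
open Polynomial CongruenceSubgroup Literature.NumberTheory.EllipticCurves Literature.NumberTheory.EllipticCurves.ModularForms
  Literature.NumberTheory.EllipticCurves.Kobayashi2003 Literature.NumberTheory.EllipticCurves.GreenbergVatsal2000
  Literature.NumberTheory.EllipticCurves.Rank1Residual Literature.NumberTheory.GaloisRepresentations IsDedekindDomain NumberField
  Rat.HeightOneSpectrum

namespace Summit.BirchSwinnertonDyer.BirchSwinnertonDyer.Theorems.SmallImageValve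

variable {p : ℕ} [Fact p.Prime] {N M : ℕ} [NeZero N] [NeZero M]

omit [NeZero M] in
/-- ★ **The one-sign analytic `μ = 0` floor at `(W, p, f)` from B1, keyed to the K-chain's depleted form.** `W/ℚ` elliptic, globally minimal,
`p` odd of good supersingular reduction (`a_p(W) = 0`), `f` a newform of `W` on `Γ₀(N)`; `S₀` a finite set of finite places of `ℚ` not above `p`;
a pair `(f₁, g₁)` on `Γ₀(M)` with the OUTPUT clauses of Vatsal's canonical-period congruence along `ι : ℚ̄_p ≃ ℂ` (`hVf hVg hVc hVu`), where the
plus symbol of `f₁` is the `S₀`-DEPLETION of `f`'s in the shape of `…RttKanDepletedForm.exists_depletedForm` (`hdep`, VERBATIM: ℂ-Euler factors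
`1 − C(a_{ℓ_v}(f))X + 𝟙_{ℓ_v∤N} ℓ_v X²`, arguments `x·∏ℓ_v^{k_v}`); and B1 on `g₁` (`hB1`, unfolded). Then `∃ ε L, IsSignedPAdicLFunction f p ε L ∧
HasUnitContent L`. [cite: GreenbergVatsal2000, §1 p. 9 (display (8))] [cite: Vatsal1999, Thm. (1.13) and Remark (1.12)] -/
theorem muOneSign_body_of_orbitUnitCert_of_depletedForm {W : WeierstrassCurve ℚ} [W.IsElliptic] [W.IsGloballyMinimal]
    {f : CuspForm (Gamma0 N) 2} (hp2 : p ≠ 2) (hf : IsNewformOf W f) (hgood : W.HasGoodReductionAtPrime p)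
    (hap : W.frobeniusTrace p = 0) (S₀ : Finset (HeightOneSpectrum (𝓞 ℚ))) (hS : ∀ v ∈ S₀, natGenerator v ≠ p)
    (ι : PadicAlgCl p ≃+* ℂ) (f₁ g₁ : CuspForm (Gamma0 M) 2) {Ωf Ωg : ℂ} (hΩf : Ωf ≠ 0)
    (hVf : ∀ x : ℚ, Valued.v (ι.symm (plusSymbol f₁ x / Ωf)) ≤ 1)
    (hVg : ∀ x : ℚ, Valued.v (ι.symm (plusSymbol g₁ x / Ωg)) ≤ 1)
    (hVc : ∀ x : ℚ, Valued.v (ι.symm (plusSymbol f₁ x / Ωf - plusSymbol g₁ x / Ωg)) < 1)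
    (hVu : ∃ x : ℚ, Valued.v (ι.symm (plusSymbol f₁ x / Ωf)) = 1)
    (hdep : ∀ x : ℚ, plusSymbol f₁ x = ∑ k ∈ Fintype.piFinset (fun _ : ↥S₀ ↦ Finset.range 3),
      (∏ v : ↥S₀, (1 - C (cuspCoeff f (natGenerator (v : HeightOneSpectrum (𝓞 ℚ)))) * X +
          (if natGenerator (v : HeightOneSpectrum (𝓞 ℚ)) ∣ N then 0
            else C ((natGenerator (v : HeightOneSpectrum (𝓞 ℚ)) : ℂ))) * X ^ 2 : ℂ[X]).coeff (k v) *
        (((natGenerator (v : HeightOneSpectrum (𝓞 ℚ)) : ℂ))⁻¹) ^ (k v)) *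
      plusSymbol f (x * ((∏ v : ↥S₀, natGenerator (v : HeightOneSpectrum (𝓞 ℚ)) ^ (k v) : ℕ) : ℚ)))
    (hB1 : ∃ c : PadicAlgCl p, (∀ x : ℚ, ‖c * ι.symm (plusSymbol g₁ x / Ωg)‖ ≤ 1) ∧
      ∃ n : ℕ, 1 ≤ n ∧ ∃ b : (ZMod (p ^ n))ˣ,
        ‖∑ t ∈ (Finset.univ : Finset (ZMod (p ^ n))).filter (fun t => t ^ (p - 1) = 1),
            c * ι.symm (plusSymbol g₁ ((((t * (b : ZMod (p ^ n))).val : ℕ) : ℚ) / (p : ℚ) ^ n) / Ωg)‖ = 1) :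
    ∃ (ε : ℤˣ) (L : IwasawaAlgebra p), IsSignedPAdicLFunction f p ε L ∧ HasUnitContent L := by
  have hp : p.Prime := Fact.out
  -- the integer Euler factors `P_v = 1 − a_{ℓ_v}(W) X + 𝟙_{ℓ_v ∤ N} ℓ_v X²`
  refine muOneSign_body_of_orbitUnitCert hp2 hf hgood hap ι f₁ g₁ hΩf hVf hVg hVc hVu
    (fun v : ↥S₀ ↦ natGenerator (v : HeightOneSpectrum (𝓞 ℚ)))
    (fun v ↦ ⟨(prime_natGenerator _).one_lt, fun h ↦ hS v v.2
      ((Nat.prime_dvd_prime_iff_eq hp (prime_natGenerator _)).mp h).symm⟩)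
    (fun v : ↥S₀ ↦ (1 - C (W.LFunction (natGenerator (v : HeightOneSpectrum (𝓞 ℚ)))) * X +
      (if natGenerator (v : HeightOneSpectrum (𝓞 ℚ)) ∣ N then 0
        else C ((natGenerator (v : HeightOneSpectrum (𝓞 ℚ)) : ℤ))) * X ^ 2 : ℤ[X]))
    (fun v ↦ by split_ifs <;> simp) (fun x ↦ ?_) hB1
  -- the ℂ-Euler factor is the image of the integer one (`a_ℓ(f) = L(W)(ℓ) ∈ ℤ`)
  have hP : ∀ v : ↥S₀, (1 - C (W.LFunction (natGenerator (v : HeightOneSpectrum (𝓞 ℚ)))) * X +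
      (if natGenerator (v : HeightOneSpectrum (𝓞 ℚ)) ∣ N then 0
        else C ((natGenerator (v : HeightOneSpectrum (𝓞 ℚ)) : ℤ))) * X ^ 2 : ℤ[X]).map (Int.castRingHom ℂ) =
      (1 - C (cuspCoeff f (natGenerator (v : HeightOneSpectrum (𝓞 ℚ)))) * X +
        (if natGenerator (v : HeightOneSpectrum (𝓞 ℚ)) ∣ N then 0
          else C ((natGenerator (v : HeightOneSpectrum (𝓞 ℚ)) : ℂ))) * X ^ 2 : ℂ[X]) := by
    intro v
    rw [hf.2 (natGenerator (v : HeightOneSpectrum (𝓞 ℚ)))]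
    split_ifs <;> simp [Polynomial.map_sub, Polynomial.map_mul]
  rw [hdep x]
  refine Finset.sum_congr rfl fun k _ ↦ ?_
  rw [mul_comm x]
  congr 1
  rw [Rat.cast_prod]
  refine Finset.prod_congr rfl fun v _ ↦ ?_
  rw [← hP v, Polynomial.coeff_map, Rat.cast_mul, Rat.cast_inv, Rat.cast_pow, Rat.cast_natCast, Rat.cast_intCast, inv_pow,
    eq_intCast]

end Summit.BirchSwinnertonDyer.BirchSwinnertonDyer.Theorems.SmallImageValve

end
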